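import Summits.CriticalPhenomena.PercolationContinuityZ3.Theorems.PercNearOneGluingNoHeavyLowerTailSimexGapCertificate
import HarnessLib

/-!
# `NoHeavyLowerTail` (stmt-CriticalPhenomena-4575): three relays — the residual of SIMEX / the D-cone is NON-CONVEX CAPTURE at a near tie

Support file (`--supports stmt-CriticalPhenomena-4575`), route task `nh-dp-commonrelay`, gen 2.  No definitions, no named facts.

Two competitors `c₁, c₂` besides the designated relay `a₀` and the target `b` (Kozma–Nitzan's open case `|A| = 3`), block `S` with
un-glued cluster `K_S`, `CAP = {K_S ∩ {c₁,c₂} ≠ ∅, a₀ ∉ K_S}`.  The gap certificate (`simexU_of_gapCertificate`) for the LOWER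
competitor `c₁` (`μ(c₁↔b) ≤ μ(c₂↔b)`) asks that its trap excess `Δ_{c₁} = μ((c₁↔b) ∩ {c₂ ∈ K_S} ∩ {c₁,a₀ ∉ K_S}) −
μ((S↔b) ∩ {c₂ ∈ K_S} ∩ {c₁,a₀ ∉ K_S})` be paid by the gap `μ(c₁↔b) − μ(a₀↔b)`.  One more sandwich exchange, `c₁ → c₂` on ALL
captures of `c₂` avoiding `c₁` (including those containing `a₀`), bounds the trap excess by the NON-CONVEX CAPTURE mass:

* `trapExcess_le_nonConvexCapture`:  `Δ_{c₁} ≤ μ((S↔b) ∩ {c₂, a₀ ∈ K_S} ∩ {c₁ ∉ K_S}) − μ((c₁↔b) ∩ {c₂, a₀ ∈ K_S} ∩ {c₁ ∉ K_S})`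
  ("the lower competitor can beat the block on the `c₂`-only captures only by as much as the block captures `a₀` and `c₂` — but not
  `c₁` — together with `b`, net of `c₁`'s leak there").
* `simexU_of_ncCertificate` / `dKernel_of_ncCertificate`: hence SIMEX and the D-cone instance (block form of KN (41) at `a₀`) hold as soon as
  `(NC₁ − ℓ₁) · μ(a₀ ↮ c₁) ≤ (μ(c₁↔b) − μ(a₀↔b)) · μ(CAP ∩ {a₀ ↮ c₁})`, `NC₁ = μ((S↔b) ∩ {c₂,a₀ ∈ K_S} ∩ {c₁ ∉ K_S})`,
  `ℓ₁ = μ((c₁↔b) ∩ {c₂,a₀ ∈ K_S} ∩ {c₁ ∉ K_S})`.  Compare the sibling crux's `blockGood_threeRelays_of_convexCapture`, whose credit for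
  the same non-convex capture is the solo capture `μ(b ∈ K_S, K_S ∩ A = {b}…)`; here the credit is the reliability gap.
So for three relays every failure of the D-cone must be a configuration class where the block captures `{a₀, c_high, b}` without
`c_low` with probability exceeding BOTH credits, at a near tie `μ(c_low↔b) ≈ μ(a₀↔b)` — the "full-tie all-bad corner" in capture language.
[cite: KozmaNitzan2024, §3.1 Thm 2 (pp. 8–9), Lemma 3 (pp. 6–7), Question 7/9 (p. 36); VandenbergHaggstromKahn2006, Thms 1.3–1.5]
-/

noncomputable section

open MeasureTheory unitInterval
open Literature.Probability.LatticeModels (prodBernoulli)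
open Literature.Probability.Percolation
open Literature.Probability.Percolation.BHK2006

namespace Summit.CriticalPhenomena.PercolationContinuityZ3.Theorems

section NCCertificate
open Set
open scoped BigOperators Classical

variable {n : ℕ}

/-- **Trap excess ≤ non-convex capture (net of the leak)**, for the lower of two competitors.  See the module docstring.
[cite: KozmaNitzan2024, Lemma 3 (pp. 6–7)] -/
theorem trapExcess_le_nonConvexCapture (u : Sym2 (Fin n) → unitInterval) (S : Finset (Fin n)) (b a₀ c₁ c₂ : Fin n)
    (h₁₂ : (prodBernoulli u).real (openConn c₁ b) ≤ (prodBernoulli u).real (openConn c₂ b)) :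
    (prodBernoulli u).real ((openConn c₁ b : Set (BondConfig (Fin n))) ∩ (⋃ v ∈ S, (openConn v c₂ : Set (BondConfig (Fin n))))
        ∩ (⋂ v ∈ S, (openConn v c₁)ᶜ) ∩ ⋂ v ∈ S, (openConn v a₀)ᶜ)
      - (prodBernoulli u).real ((⋃ v ∈ S, (openConn v b : Set (BondConfig (Fin n)))) ∩ (⋃ v ∈ S, (openConn v c₂ : Set (BondConfig (Fin n))))
        ∩ (⋂ v ∈ S, (openConn v c₁)ᶜ) ∩ ⋂ v ∈ S, (openConn v a₀)ᶜ)
    ≤ (prodBernoulli u).real ((⋃ v ∈ S, (openConn v b : Set (BondConfig (Fin n)))) ∩ (⋃ v ∈ S, (openConn v c₂ : Set (BondConfig (Fin n))))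
        ∩ (⋂ v ∈ S, (openConn v c₁)ᶜ) ∩ ⋃ v ∈ S, (openConn v a₀ : Set (BondConfig (Fin n))))
      - (prodBernoulli u).real ((openConn c₁ b : Set (BondConfig (Fin n))) ∩ (⋃ v ∈ S, (openConn v c₂ : Set (BondConfig (Fin n))))
        ∩ (⋂ v ∈ S, (openConn v c₁)ᶜ) ∩ ⋃ v ∈ S, (openConn v a₀ : Set (BondConfig (Fin n)))) := by
  set μ := prodBernoulli u with hμ
  set S2 : Set (BondConfig (Fin n)) := ⋃ v ∈ S, (openConn v c₂ : Set (BondConfig (Fin n))) with hS2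
  set S1c : Set (BondConfig (Fin n)) := ⋂ v ∈ S, (openConn v c₁ : Set (BondConfig (Fin n)))ᶜ with hS1c
  set SA : Set (BondConfig (Fin n)) := ⋃ v ∈ S, (openConn v a₀ : Set (BondConfig (Fin n))) with hSA
  set SAc : Set (BondConfig (Fin n)) := ⋂ v ∈ S, (openConn v a₀ : Set (BondConfig (Fin n)))ᶜ with hSAc
  set SB : Set (BondConfig (Fin n)) := ⋃ v ∈ S, (openConn v b : Set (BondConfig (Fin n))) with hSB
  have hms : ∀ s : Set (BondConfig (Fin n)), MeasurableSet s := fun s => (Set.toFinite s).measurableSet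
  -- sandwich exchange `c₁ → c₂` on all captures of `c₂` avoiding `c₁`
  set 𝓕 : Set (Set (Fin n)) := {T | c₂ ∈ T ∧ c₁ ∉ T} with h𝓕
  have hQ : {ω : BondConfig (Fin n) | (⋃ o ∈ S, openCluster ω o) ∈ 𝓕} = S2 ∩ S1c := by
    ext ω
    simp only [h𝓕, hS2, hS1c, Set.mem_setOf_eq, Set.mem_inter_iff, Set.mem_iUnion, Set.mem_iInter, Set.mem_compl_iff,
      exists_prop]
    constructor
    · rintro ⟨⟨v, hv, hv2⟩, hn1⟩
      exact ⟨⟨v, hv, hv2⟩, fun v hv h => hn1 ⟨v, hv, h⟩⟩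
    · rintro ⟨⟨v, hv, hv2⟩, hn1⟩
      exact ⟨⟨v, hv, hv2⟩, fun ⟨v, hv, h⟩ => hn1 v hv h⟩
  have hlo : ∀ ω : BondConfig (Fin n), c₂ ∈ (⋃ o ∈ S, openCluster ω o) → c₁ ∉ (⋃ o ∈ S, openCluster ω o) →
      (⋃ o ∈ S, openCluster ω o) ∈ 𝓕 := fun ω h1 h2 => ⟨h1, h2⟩
  have hhi : ∀ ω : BondConfig (Fin n), (⋃ o ∈ S, openCluster ω o) ∈ 𝓕 → c₁ ∉ (⋃ o ∈ S, openCluster ω o) := fun ω h => h.2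
  have hsand := SandwichSet.lemma3_sandwich_set u c₁ c₂ b S 𝓕 hlo hhi h₁₂
  rw [hQ] at hsand
  -- `SAc = SAᶜ`
  have hcomp : SAc = SAᶜ := by
    ext ω; simp only [hSAc, hSA, Set.mem_iInter, Set.mem_compl_iff, Set.mem_iUnion, exists_prop, not_exists, not_and]
  -- split both sides of the exchange along `a₀ ∈ K_S`
  have hL : μ.real ((openConn c₁ b : Set (BondConfig (Fin n))) ∩ (S2 ∩ S1c)) =
      μ.real ((openConn c₁ b : Set (BondConfig (Fin n))) ∩ (S2 ∩ S1c) ∩ SA) + μ.real (((openConn c₁ b : Set (BondConfig (Fin n))) ∩ (S2 ∩ S1c)) \ SA) :=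
    (measureReal_inter_add_sdiff (hms SA) (measure_ne_top _ _)).symm
  have hR : μ.real ((openConn c₂ b : Set (BondConfig (Fin n))) ∩ (S2 ∩ S1c)) =
      μ.real ((openConn c₂ b : Set (BondConfig (Fin n))) ∩ (S2 ∩ S1c) ∩ SA) + μ.real (((openConn c₂ b : Set (BondConfig (Fin n))) ∩ (S2 ∩ S1c)) \ SA) :=
    (measureReal_inter_add_sdiff (hms SA) (measure_ne_top _ _)).symm
  -- `c₂ ∈ K_S` and `c₂ ↔ b` put `b` in `K_S`
  have hsub1 : (openConn c₂ b : Set (BondConfig (Fin n))) ∩ (S2 ∩ S1c) ∩ SA ⊆ SB ∩ S2 ∩ S1c ∩ SA := by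
    rintro ω ⟨⟨h2b, h2, h1⟩, ha⟩
    refine ⟨⟨⟨?_, h2⟩, h1⟩, ha⟩
    simp only [hS2, Set.mem_iUnion, exists_prop] at h2
    obtain ⟨v, hv, hv2⟩ := h2
    simp only [hSB, Set.mem_iUnion, exists_prop]
    exact ⟨v, hv, blockGrowth_openConn_trans hv2 h2b⟩
  have hsub2 : ((openConn c₂ b : Set (BondConfig (Fin n))) ∩ (S2 ∩ S1c)) \ SA ⊆ (SB ∩ S2 ∩ S1c) \ SA := by
    rintro ω ⟨⟨h2b, h2, h1⟩, hna⟩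
    refine ⟨⟨⟨?_, h2⟩, h1⟩, hna⟩
    simp only [hS2, Set.mem_iUnion, exists_prop] at h2
    obtain ⟨v, hv, hv2⟩ := h2
    simp only [hSB, Set.mem_iUnion, exists_prop]
    exact ⟨v, hv, blockGrowth_openConn_trans hv2 h2b⟩
  have e1 := measureReal_mono (μ := μ) hsub1 (measure_ne_top _ _)
  have e2 := measureReal_mono (μ := μ) hsub2 (measure_ne_top _ _)
  -- rewrite the four events of the statement in this notation
  have r1 : (openConn c₁ b : Set (BondConfig (Fin n))) ∩ S2 ∩ S1c ∩ SAc = ((openConn c₁ b : Set (BondConfig (Fin n))) ∩ (S2 ∩ S1c)) \ SA := by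
    rw [hcomp]; ext ω; simp only [Set.mem_inter_iff, Set.mem_sdiff, Set.mem_compl_iff]; tauto
  have r2 : SB ∩ S2 ∩ S1c ∩ SAc = (SB ∩ S2 ∩ S1c) \ SA := by
    rw [hcomp]; ext ω; simp only [Set.mem_inter_iff, Set.mem_sdiff, Set.mem_compl_iff]
  have r3 : (openConn c₁ b : Set (BondConfig (Fin n))) ∩ S2 ∩ S1c ∩ SA = (openConn c₁ b : Set (BondConfig (Fin n))) ∩ (S2 ∩ S1c) ∩ SA := by
    ext ω; simp only [Set.mem_inter_iff]; tauto
  rw [r1, r2, r3]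
  linarith

/-- **Non-convex-capture certificate for SIMEX, three relays (un-glued form).**  If the competitors of `a₀` are exactly `c₁, c₂`
with `μ(c₁↔b) ≤ μ(c₂↔b)`, `μ(a₀ ↮ c₁) > 0`, and the net non-convex capture is paid by the gap,
`(NC₁ − ℓ₁) · μ(a₀ ↮ c₁) ≤ (μ(c₁↔b) − μ(a₀↔b)) · μ(CAP ∩ {a₀ ↮ c₁})`, then SIMEX holds. [cite: KozmaNitzan2024, Lemma 3 (pp. 6–7)] -/
theorem simexU_of_ncCertificate (u : Sym2 (Fin n) → unitInterval) (A S : Finset (Fin n)) (b a₀ c₁ c₂ : Fin n)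
    (hA : (A.erase b).erase a₀ = {c₁, c₂})
    (h₁₂ : (prodBernoulli u).real (openConn c₁ b) ≤ (prodBernoulli u).real (openConn c₂ b))
    (hD : 0 < (prodBernoulli u).real (openConn a₀ c₁ : Set (BondConfig (Fin n)))ᶜ)
    (hNC : ((prodBernoulli u).real ((⋃ v ∈ S, (openConn v b : Set (BondConfig (Fin n)))) ∩ (⋃ v ∈ S, (openConn v c₂ : Set (BondConfig (Fin n))))
                ∩ (⋂ v ∈ S, (openConn v c₁)ᶜ) ∩ ⋃ v ∈ S, (openConn v a₀ : Set (BondConfig (Fin n))))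
            - (prodBernoulli u).real ((openConn c₁ b : Set (BondConfig (Fin n))) ∩ (⋃ v ∈ S, (openConn v c₂ : Set (BondConfig (Fin n))))
                ∩ (⋂ v ∈ S, (openConn v c₁)ᶜ) ∩ ⋃ v ∈ S, (openConn v a₀ : Set (BondConfig (Fin n)))))
            * (prodBernoulli u).real (openConn a₀ c₁ : Set (BondConfig (Fin n)))ᶜ
          ≤ ((prodBernoulli u).real (openConn c₁ b) - (prodBernoulli u).real (openConn a₀ b))
            * (prodBernoulli u).real
              ((((⋃ v ∈ S, ⋃ a ∈ (A.erase b).erase a₀, (openConn v a : Set (BondConfig (Fin n)))) ∩ ⋂ v ∈ S, (openConn v a₀)ᶜ))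
                ∩ (openConn a₀ c₁)ᶜ)) :
    (prodBernoulli u).real
        ((openConn a₀ b : Set (BondConfig (Fin n)))
          ∩ ((⋃ v ∈ S, ⋃ a ∈ (A.erase b).erase a₀, (openConn v a : Set (BondConfig (Fin n)))) ∩ ⋂ v ∈ S, (openConn v a₀)ᶜ))
      ≤ (prodBernoulli u).real
        ((⋃ v ∈ S, (openConn v b : Set (BondConfig (Fin n))))
          ∩ ((⋃ v ∈ S, ⋃ a ∈ (A.erase b).erase a₀, (openConn v a : Set (BondConfig (Fin n)))) ∩ ⋂ v ∈ S, (openConn v a₀)ᶜ)) := by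
  have hc : c₁ ∈ (A.erase b).erase a₀ := by rw [hA]; simp
  refine simexU_of_gapCertificate u A S b a₀ c₁ hc hD ?_
  -- the trap excess of `c₁` is at most the net non-convex capture; both events `CAP ∩ {c₁ ∉ K_S}` reduce to `{c₂ ∈ K_S, c₁,a₀ ∉ K_S}`
  have hev : ((⋃ v ∈ S, ⋃ a ∈ (A.erase b).erase a₀, (openConn v a : Set (BondConfig (Fin n)))) ∩ ⋂ v ∈ S, (openConn v a₀)ᶜ)
      ∩ (⋂ v ∈ S, (openConn v c₁ : Set (BondConfig (Fin n)))ᶜ) =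
      (⋃ v ∈ S, (openConn v c₂ : Set (BondConfig (Fin n)))) ∩ (⋂ v ∈ S, (openConn v c₁)ᶜ) ∩ ⋂ v ∈ S, (openConn v a₀)ᶜ := by
    rw [hA]; ext ω
    simp only [Set.mem_inter_iff, Set.mem_iUnion, Set.mem_iInter, Set.mem_compl_iff, exists_prop, Finset.mem_insert,
      Finset.mem_singleton]
    constructor
    · rintro ⟨⟨⟨v, hv, a, ha, hva⟩, hna⟩, hn1⟩
      rcases ha with rfl | rfl
      · exact absurd hva (hn1 v hv)
      · exact ⟨⟨⟨v, hv, hva⟩, hn1⟩, hna⟩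
    · rintro ⟨⟨⟨v, hv, hv2⟩, hn1⟩, hna⟩
      exact ⟨⟨⟨v, hv, c₂, Or.inr rfl, hv2⟩, hna⟩, hn1⟩
  have hL : (openConn c₁ b : Set (BondConfig (Fin n)))
        ∩ ((⋃ v ∈ S, ⋃ a ∈ (A.erase b).erase a₀, (openConn v a : Set (BondConfig (Fin n)))) ∩ ⋂ v ∈ S, (openConn v a₀)ᶜ)
        ∩ (⋂ v ∈ S, (openConn v c₁ : Set (BondConfig (Fin n)))ᶜ) =
      (openConn c₁ b : Set (BondConfig (Fin n))) ∩ (⋃ v ∈ S, (openConn v c₂ : Set (BondConfig (Fin n))))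
        ∩ (⋂ v ∈ S, (openConn v c₁)ᶜ) ∩ ⋂ v ∈ S, (openConn v a₀)ᶜ := by
    rw [Set.inter_assoc, hev, ← Set.inter_assoc, ← Set.inter_assoc]
  have hR : (⋃ v ∈ S, (openConn v b : Set (BondConfig (Fin n))))
        ∩ ((⋃ v ∈ S, ⋃ a ∈ (A.erase b).erase a₀, (openConn v a : Set (BondConfig (Fin n)))) ∩ ⋂ v ∈ S, (openConn v a₀)ᶜ)
        ∩ (⋂ v ∈ S, (openConn v c₁ : Set (BondConfig (Fin n)))ᶜ) =
      (⋃ v ∈ S, (openConn v b : Set (BondConfig (Fin n)))) ∩ (⋃ v ∈ S, (openConn v c₂ : Set (BondConfig (Fin n))))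
        ∩ (⋂ v ∈ S, (openConn v c₁)ᶜ) ∩ ⋂ v ∈ S, (openConn v a₀)ᶜ := by
    rw [Set.inter_assoc, hev, ← Set.inter_assoc, ← Set.inter_assoc]
  rw [hL, hR]
  have hT := trapExcess_le_nonConvexCapture u S b a₀ c₁ c₂ h₁₂
  have hDn : 0 ≤ (prodBernoulli u).real (openConn a₀ c₁ : Set (BondConfig (Fin n)))ᶜ := measureReal_nonneg
  nlinarith [hT, hNC, hDn]

/-- **The D-cone instance (block form of KN (41)) at three relays from the non-convex-capture certificate.**
[cite: KozmaNitzan2024, (41) p. 36, Thm 2 (pp. 8–9)] -/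
theorem dKernel_of_ncCertificate (u : Sym2 (Fin n) → unitInterval) (A S : Finset (Fin n)) (b a₀ c₁ c₂ : Fin n)
    (hb : b ∈ A) (hA : (A.erase b).erase a₀ = {c₁, c₂})
    (h₁₂ : (prodBernoulli u).real (openConn c₁ b) ≤ (prodBernoulli u).real (openConn c₂ b))
    (hD : 0 < (prodBernoulli u).real (openConn a₀ c₁ : Set (BondConfig (Fin n)))ᶜ)
    (hNC : ((prodBernoulli u).real ((⋃ v ∈ S, (openConn v b : Set (BondConfig (Fin n)))) ∩ (⋃ v ∈ S, (openConn v c₂ : Set (BondConfig (Fin n))))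
                ∩ (⋂ v ∈ S, (openConn v c₁)ᶜ) ∩ ⋃ v ∈ S, (openConn v a₀ : Set (BondConfig (Fin n))))
            - (prodBernoulli u).real ((openConn c₁ b : Set (BondConfig (Fin n))) ∩ (⋃ v ∈ S, (openConn v c₂ : Set (BondConfig (Fin n))))
                ∩ (⋂ v ∈ S, (openConn v c₁)ᶜ) ∩ ⋃ v ∈ S, (openConn v a₀ : Set (BondConfig (Fin n)))))
            * (prodBernoulli u).real (openConn a₀ c₁ : Set (BondConfig (Fin n)))ᶜ
          ≤ ((prodBernoulli u).real (openConn c₁ b) - (prodBernoulli u).real (openConn a₀ b))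
            * (prodBernoulli u).real
              ((((⋃ v ∈ S, ⋃ a ∈ (A.erase b).erase a₀, (openConn v a : Set (BondConfig (Fin n)))) ∩ ⋂ v ∈ S, (openConn v a₀)ᶜ))
                ∩ (openConn a₀ c₁)ᶜ)) :
    (prodBernoulli (fun e : Sym2 (Fin n) => if (∀ y ∈ e, y ∈ S) ∧ ¬ e.IsDiag then 1 else u e)).real
        ((⋃ v ∈ S, ⋃ a ∈ A, (openConn v a : Set (BondConfig (Fin n)))) ∩ openConn a₀ b)
      ≤ (prodBernoulli (fun e : Sym2 (Fin n) => if (∀ y ∈ e, y ∈ S) ∧ ¬ e.IsDiag then 1 else u e)).real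
        (⋃ v ∈ S, (openConn v b : Set (BondConfig (Fin n)))) := by
  refine dKernel_of_simex_instance _ A S b a₀ hb ?_
  rw [simex_glue_lhs, simex_glue_rhs]
  exact simexU_of_ncCertificate u A S b a₀ c₁ c₂ hA h₁₂ hD hNC

end NCCertificate

end Summit.CriticalPhenomena.PercolationContinuityZ3.Theorems

end
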